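import Mathlib
import Summits.QuantumFields.BalabanUV.Beta.FP.MarginalUniqueness

/-!
# Road «FP» (binder row D1), leaf N7d-gauge (GERM-S, the invariant-theory half): the tree-level WARD identity fixes the
# coefficient of the unique cubic germ AND forces the quadratic germ to be covariant-transverse

`FP/MarginalUniqueness.cubic_unique`: a cubic germ `L` that is hyperoctahedrally invariant and Bose-symmetric is `c · ymGerm`
with ONE free coefficient `c = L 0 0 1 1 0`.  This file adds the second half of «uniqueness does the identification» for the vertex
normalisation (skeleton §3 N7d, `REP-DESIGN.md` GERM-S): the TREE-LEVEL WARD IDENTITY between the cubic germ and the quadratic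
germ (background leg contracted with its own momentum `r = −p−q`),

  `Σ_{λ,κ} r_λ · (L μ ν λ κ 0 · p_κ + L μ ν λ κ 1 · q_κ) = Q(q)_{μν} − Q(p)_{μν}`  for all `p q μ ν`,

with the GENERAL hyperoctahedrally-invariant quadratic germ `Q(k)_{μν} = cQ·(|k|²δ_{μν} − k_μk_ν) + α·k_μk_ν + γ·δ_{μν}k_μ²`
(three invariants: the `B₄`-symmetric rank-2 tensors quadratic in `k`), FORCES `c = cQ`, `α = 0`, `γ = 0`:
* §1 `quadGerm`, `WardGerm`; **`wardGerm_ymGerm`** — the Yang–Mills germ satisfies the identity with `Q = |k|²δ − kk` (`cQ = 1`);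
* §2 **`coeff_eq_of_wardGerm`** — `WardGerm (c • ymGerm) (quadGerm cQ α γ) → c = cQ ∧ α = 0 ∧ γ = 0` (three test momenta);
* §3 **`cubic_eq_of_symmetric_ward`** — with `cubic_unique`: symmetry + Ward ⟹ `L = cQ · ymGerm` and the quadratic germ has no
  non-covariant (`γ`) and no longitudinal (`α`) part.  So the bubble's prefactor `(c · c_K)²` with `c_K = 1/cQ` (propagator germ =
  inverse quadratic germ on transverse modes) is `1`: NO normalisation constant survives — the marginal coefficient is scheme-rigid.
Pure finite-dimensional algebra over `ℝ` (Mathlib only); [our object]/[folklore]; nothing about Bałaban's operators is asserted (that the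
perfect vertex/propagator germs SATISFY these hypotheses is GERM-S's analytic half: Ward identities of the perfect action, N3(iii)).
HONEST FRAMING: bookkeeping toward `hident` (GAPS O-asym1-7); discharges nothing of `BetaPertH`; NOT the continuum limit, NOT Clay.
-/

namespace Summit.QuantumFields.BalabanUV.Beta.FP.WardNormalisation

open Summit.QuantumFields.BalabanUV.Beta.FP.MarginalUniqueness

/-! ## §1 The quadratic germ, the Ward predicate, and the Yang–Mills germ satisfies it -/

/-- [our object] Squared Euclidean length of a momentum. -/
def nsq (k : Idx → ℝ) : ℝ := ∑ i, k i * k i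

/-- [our object] **The general `B₄`-invariant quadratic germ**: `Q(k)_{μν} = cQ(|k|²δ_{μν} − k_μk_ν) + α k_μk_ν + γ δ_{μν} k_μ²`. -/
def quadGerm (cQ α γ : ℝ) (k : Idx → ℝ) (μ ν : Idx) : ℝ :=
  cQ * (nsq k * δ μ ν - k μ * k ν) + α * (k μ * k ν) + γ * (δ μ ν * (k μ * k μ))

/-- [our object] **Tree-level Ward identity at germ level**: contracting the background leg (index `λ`, momentum `r = −p−q`) of the cubic
form with its own momentum gives the difference of quadratic germs. -/
def WardGerm (L : CubicGerm) (Q : (Idx → ℝ) → Idx → Idx → ℝ) : Prop :=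
  ∀ (p q : Idx → ℝ) (μ ν : Idx),
    ∑ lam, ∑ κ, (-(p lam + q lam)) * (L μ ν lam κ 0 * p κ + L μ ν lam κ 1 * q κ) = Q q μ ν - Q p μ ν

/-- [our object] the unit momentum along axis `a`. -/
def e (a : Idx) : Idx → ℝ := fun i => if i = a then 1 else 0

/-- [folklore] **THE (SCALED) YANG–MILLS GERM SATISFIES THE TREE-LEVEL WARD IDENTITY** with the transverse quadratic germ
`c·(|k|²δ − kk)`: `r^λ (c·V)_{μνλ}(p,q,r) = c·(Q^T(q) − Q^T(p))` — by brute force over the `4 × 4` index pairs. -/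
theorem wardGerm_smul_ymGerm (c : ℝ) : WardGerm (fun μ ν lam κ i => c * ymGerm μ ν lam κ i) (quadGerm c 0 0) := by
  intro p q μ ν
  fin_cases μ <;> fin_cases ν <;>
    simp [Fin.sum_univ_four, ymGerm, quadGerm, δ, nsq] <;> ring

/-- [folklore] The Yang–Mills germ itself (`c = 1`). -/
theorem wardGerm_ymGerm : WardGerm ymGerm (quadGerm 1 0 0) := by
  have h := wardGerm_smul_ymGerm 1
  simp only [one_mul] at h
  exact h

/-! ## §2 The Ward identity fixes the coefficient and kills the non-covariant quadratic invariants -/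

/-- [folklore] **WARD FIXES THE NORMALISATION.**  If `c · ymGerm` satisfies the germ-level Ward identity with the general
`B₄`-invariant quadratic germ `quadGerm cQ α γ`, then `c = cQ`, `α = 0`, `γ = 0` (three test configurations:
`(p,q,μ,ν) = (e₁, 0, 0, 0)`, `(e₀+e₁, e₂, 0, 1)`, `(e₀, e₁, 0, 0)`). -/
theorem coeff_eq_of_wardGerm {c cQ α γ : ℝ}
    (h : WardGerm (fun μ ν lam κ i => c * ymGerm μ ν lam κ i) (quadGerm cQ α γ)) : c = cQ ∧ α = 0 ∧ γ = 0 := by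
  have h1 := h (e 1) (fun _ => 0) 0 0
  have h2 := h (fun i => e 0 i + e 1 i) (e 2) 0 1
  have h3 := h (e 0) (e 1) 0 0
  simp [Fin.sum_univ_four, ymGerm, quadGerm, δ, nsq, e] at h1 h2 h3
  refine ⟨by linarith, by linarith, by linarith⟩

/-! ## §3 Symmetry + Ward ⟹ the cubic germ is EXACTLY `cQ · ymGerm` -/

/-- [folklore] **UNIQUENESS DOES THE IDENTIFICATION (vertex normalisation).**  A hyperoctahedrally invariant, Bose-symmetric cubic germ
obeying the germ-level Ward identity against the quadratic germ `quadGerm cQ α γ` IS `cQ · ymGerm`, and the quadratic germ is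
covariant-transverse (`α = γ = 0`). -/
theorem cubic_eq_of_symmetric_ward {L : CubicGerm} (hP : PermInvariant L) (hF : FlipInvariant L) (h12 : Anti12 L) (h13 : Anti13 L)
    {cQ α γ : ℝ} (hW : WardGerm L (quadGerm cQ α γ)) :
    (∀ μ ν lam κ i, L μ ν lam κ i = cQ * ymGerm μ ν lam κ i) ∧ α = 0 ∧ γ = 0 := by
  have hL : L = fun μ ν lam κ i => L 0 0 1 1 0 * ymGerm μ ν lam κ i :=
    funext fun μ => funext fun ν => funext fun lam => funext fun κ => funext fun i => cubic_unique hP hF h12 h13 μ ν lam κ i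
  rw [hL] at hW
  obtain ⟨hc, hα, hγ⟩ := coeff_eq_of_wardGerm hW
  refine ⟨fun μ ν lam κ i => ?_, hα, hγ⟩
  rw [cubic_unique hP hF h12 h13 μ ν lam κ i, hc]

end Summit.QuantumFields.BalabanUV.Beta.FP.WardNormalisation
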